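import Mathlib
import HarnessLib
import Literature.Analysis.FluidPDE.WholeSpaceIBP
import Literature.Analysis.FluidPDE.NewtonKernel
import Literature.Analysis.FluidPDE.NormalisedPressureFarFieldLimit
import Summits.NavierStokesRegularity.NavierStokesRegularity.Theorems.UnthreadedRigidityDoorUnthreadedRigidityVirialHornShellCalculus
import Summits.NavierStokesRegularity.NavierStokesRegularity.Theorems.UnthreadedRigidityDoorUnthreadedRigidityThreadingJetsSplit

/-!
# Route `UnthreadedRigidityDoor`, item `UnthreadedRigidity` (W2, stmt-NavierStokesRegularity-27585) — THREADING JETS, VIRIAL FIELDS: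
# the rotation field `y × ∇Y`, the angular form `A = {Y,|∇Y|²}` and its bracket `A₂ = {Y,A}`, and the WEIGHTED INTEGRATION-BY-PARTS IDENTITY
# behind the (F3) VIRIAL LEMMA — WITHOUT spherical harmonics (LINE g11-1 «VIRIAL HORN», half (B′) `VirialLemmaSlice` of dss_146 (1))

Seat ns-crc-p1 g8, `--supports stmt-NavierStokesRegularity-27585 --as helper`.  Inputs BY NAME: engine-1 g71's jets of solid harmonics
(`IsSolidHarmonic.angForm_eq`, `gradient_smul`, `hessian_smul`, `contDiff_gradient/hessian`, p703890), crc-p2 g8's radial calculus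
(`VirialHorn.contDiff_radial`, `VirialHorn.gradient_radial`, p704633), the tree's `fderiv_homogeneous` / `fderiv_apply_self_of_homogeneous`,
`divergence_cross_holds`, `curl_gradient_eq_zero_holds`, `divergence_smul_apply`, `integral_inner_gradient_eq_neg_integral_mul_divergence`.

THE POINT (a harmonic-free route to (F3)).  The premise of `VirialLemmaSlice` reads `α(|y|)² A(y) = {Y, g}(y)` with `g = y·∇q` (`q` the pressure
slice about the centre) and `{Y, g} = ⟪R, ∇g⟫`, `R = y × ∇Y` — a divergence-free field tangent to every sphere.  Multiplying by `A(y) θ(|y|²)` and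
integrating by parts TWICE on `ℝ³` (no spheres, no harmonics, no Poisson equation):
  `∫ α² A² θ(|y|²) dy = ∫ q · ((4l−1) θ(|y|²) + 2|y|² θ′(|y|²)) · A₂ dy`      (`integral_virial_identity`),
with `A₂ = {Y, A}` (Euler: `y·∇A₂ = (4l−4) A₂`); and `A₂` has ZERO SHELL AVERAGES, `∫ θ(|y|²) A₂ dy = 0` (`integral_radialTest_mul_pbr_angForm`).
With the weights `θ(s) = κ(s) s^{−(4l−1)/2}` the `θ`-term cancels and only `κ′` survives; letting the plateau `κ ↑ 1` kills the right side
(`q → 0` at infinity near the outer ramp, `q − q(0)` small near the inner ramp thanks to the zero shell averages) — the sequel `…VirialLemma.lean`.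

* §1 `cross_smul_smul`, `gradient_mul'`, `pbr_eq_inner_cross`,
  ★ `divergence_cross_gradient_eq_zero` (`div (y × ∇Y) = 0`), `contDiff_cross_gradient`;
* §2 `contDiff_angForm`, ★ `angForm_smul` (`A(cy) = c^{3l−3}A(y)`), `gradient_angForm_smul`, `contDiff_pbr_angForm`, ★ `pbr_angForm_smul`
  (`A₂(cy) = c^{4l−4}A₂(y)`), ★ `inner_gradient_pbr_angForm_self` (Euler);
* §3 radial tests `θ(|y|²)`: `contDiff_radialTest`, `hasCompactSupport_radialTest`, `inner_cross_gradient_radialTest` (`⟪y × w, ∇Θ⟫ = 0`),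
  `inner_gradient_radialTest_self` (`⟪∇Θ, y⟫ = 2|y|²θ′`), `divergence_smul_id`;
* §4 ★ `integral_radialTest_mul_pbr_angForm`, `integral_virial_ibp_one`, `integral_virial_ibp_two`, ★★ `integral_virial_identity`.

HONEST FRAMING: explicit-field calculus toward the L-half (B′) of one RUNG line's bridge; (B′) itself is NOT proved in this file; nothing here bears on
`UnthreadedRigidity` (27585), the door Target, W2 or Navier–Stokes regularity; no summit statement is proved.  MODEL/rung work. [folklore]
-/

noncomputable section

-- the summit and its single sub-problem share the name (CONVENTIONS §1), as in every Theorems file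
set_option linter.dupNamespace false

namespace Summit.NavierStokesRegularity.NavierStokesRegularity.Theorems.UnthreadedRigidity.ThreadingJets

open Set Function Filter Topology MeasureTheory
open scoped RealInnerProductSpace InnerProductSpace ContDiff
open Literature.Analysis.FluidPDE
open Summit.NavierStokesRegularity.NavierStokesRegularity.Theorems.UnthreadedRigidity.ProfileHorn (E3)
open Summit.NavierStokesRegularity.NavierStokesRegularity.Theorems.UnthreadedRigidity.VirialHorn
  (IsSolidHarmonic angForm pbr det3)

variable {l : ℕ} {Y : E3 → ℝ}

/-! ### 1. Coordinates: `det`, `cross`, the rotation field `R = y × ∇Y` -/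

/-- bilinearity of the cross product in both slots at once. [folklore] -/
theorem cross_smul_smul (a b : ℝ) (v w : E3) : cross (a • v) (b • w) = (a * b) • cross v w := by
  ext i
  fin_cases i <;> simp [cross, cross_apply] <;> ring

/-- gradient of a product of scalar functions. [folklore] -/
theorem gradient_mul' {f g : E3 → ℝ} {x : E3} (hf : DifferentiableAt ℝ f x) (hg : DifferentiableAt ℝ g x) :
    gradient (fun y => f y * g y) x = f x • gradient g x + g x • gradient f x := by
  unfold gradient
  rw [fderiv_fun_mul hf hg, map_add, LinearIsometryEquiv.map_smul, LinearIsometryEquiv.map_smul]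

/-- the bracket through the rotation field: `{Y, g}(y) = ⟪y × ∇Y(y), ∇g(y)⟫`. [folklore] -/
theorem pbr_eq_inner_cross (Y g : E3 → ℝ) (y : E3) : pbr Y g y = ⟪cross y (gradient Y y), gradient g y⟫ :=
  det3_eq_inner_cross _ _ _

/-- **The rotation field `y × ∇Y` is divergence free** (`div(v × w) = ⟪w, curl v⟫ − ⟪v, curl w⟫`, `curl id = 0`, `curl ∇Y = 0`). [folklore] -/
theorem divergence_cross_gradient_eq_zero (hY : IsSolidHarmonic l Y) (y : E3) :
    VectorCalculus.divergence (fun z : E3 => cross z (gradient Y z)) y = 0 := by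
  have hg : DifferentiableAt ℝ (gradient Y) y := (hY.contDiff_gradient.differentiable (by simp)) y
  have hcid : curl (fun z : E3 => z) y = 0 := by
    rw [curl_eq_curlCLM, fderiv_fun_id]
    ext i
    fin_cases i <;> simp [curlCLM_apply]
  rw [divergence_cross_holds (fun z : E3 => z) (gradient Y) y differentiableAt_id hg, hcid,
    curl_gradient_eq_zero_holds Y (hY.contDiff.of_le (by norm_cast)) y]
  simp

/-- The rotation field is smooth. [folklore] -/
theorem contDiff_cross_gradient (hY : IsSolidHarmonic l Y) : ContDiff ℝ ∞ (fun z : E3 => cross z (gradient Y z)) := by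
  have : (fun z : E3 => cross z (gradient Y z)) = fun z => crossCLM z (gradient Y z) := by funext z; rfl
  rw [this]
  exact crossCLM.isBoundedBilinearMap.contDiff.comp (contDiff_id.prodMk hY.contDiff_gradient)

/-! ### 2. The angular form `A = {Y,|∇Y|²}` and its bracket `A₂ = {Y, A}`: smoothness, homogeneity, Euler -/

/-- The angular form of a solid harmonic is smooth. [folklore] -/
theorem contDiff_angForm (hY : IsSolidHarmonic l Y) : ContDiff ℝ ∞ (angForm Y) := by
  have e : angForm Y = fun y => 2 * ⟪cross y (gradient Y y), fderiv ℝ (gradient Y) y (gradient Y y)⟫ :=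
    funext fun y => hY.angForm_eq y
  rw [e]
  exact contDiff_const.mul ((contDiff_cross_gradient hY).inner ℝ
    (hY.contDiff_hessian.clm_apply hY.contDiff_gradient))

/-- **Homogeneity of the angular form**: `A(c y) = c^{3l−3} A(y)` for `c > 0`. [folklore] -/
theorem angForm_smul (hY : IsSolidHarmonic l Y) {c : ℝ} (hc : 0 < c) (y : E3) :
    angForm Y (c • y) = c ^ ((3 * l : ℤ) - 3) * angForm Y y := by
  rw [hY.angForm_eq, hY.angForm_eq, hY.gradient_smul c hc, hY.hessian_smul c hc]
  have e1 : cross (c • y) (c ^ ((l : ℤ) - 1) • gradient Y y) = (c * c ^ ((l : ℤ) - 1)) • cross y (gradient Y y) :=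
    cross_smul_smul _ _ _ _
  rw [e1, FunLike.coe_smul, Pi.smul_apply, map_smul, real_inner_smul_left, real_inner_smul_right,
    real_inner_smul_right]
  have key : c * c ^ ((l : ℤ) - 1) * (c ^ ((l : ℤ) - 1 - 1) * c ^ ((l : ℤ) - 1)) = c ^ ((3 * l : ℤ) - 3) := by
    rw [show ((3 * l : ℤ) - 3) = 1 + ((l : ℤ) - 1) + (((l : ℤ) - 1 - 1) + ((l : ℤ) - 1)) by ring,
      zpow_add₀ hc.ne', zpow_add₀ hc.ne', zpow_add₀ hc.ne', zpow_one]
  linear_combination (2 * ⟪cross y (gradient Y y), (fderiv ℝ (gradient Y) y) (gradient Y y)⟫) * key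

/-- Homogeneity of the angular form in the `zpow • ` form used by `fderiv_homogeneous`. [folklore] -/
theorem angForm_smul' (hY : IsSolidHarmonic l Y) : ∀ c : ℝ, 0 < c → ∀ z : E3,
    angForm Y (c • z) = c ^ ((3 * l : ℤ) - 3) • angForm Y z := fun c hc z => by
  rw [angForm_smul hY hc, smul_eq_mul]

/-- The gradient of the angular form scales with degree `3l − 4`. [folklore] -/
theorem gradient_angForm_smul (hY : IsSolidHarmonic l Y) {c : ℝ} (hc : 0 < c) (y : E3) :
    gradient (angForm Y) (c • y) = c ^ ((3 * l : ℤ) - 3 - 1) • gradient (angForm Y) y := by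
  have h := fderiv_homogeneous (angForm Y) ((3 * l : ℤ) - 3) (angForm_smul' hY) c hc y
  show (InnerProductSpace.toDual ℝ E3).symm (fderiv ℝ (angForm Y) (c • y)) =
    c ^ ((3 * l : ℤ) - 3 - 1) • (InnerProductSpace.toDual ℝ E3).symm (fderiv ℝ (angForm Y) y)
  rw [h, LinearIsometryEquiv.map_smulₛₗ]
  simp

/-- The bracket `A₂ = {Y, A}` of the angular form is smooth. [folklore] -/
theorem contDiff_pbr_angForm (hY : IsSolidHarmonic l Y) : ContDiff ℝ ∞ (pbr Y (angForm Y)) := by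
  have e : pbr Y (angForm Y) = fun y => ⟪cross y (gradient Y y), gradient (angForm Y) y⟫ :=
    funext fun y => pbr_eq_inner_cross _ _ _
  rw [e]
  have hg : ContDiff ℝ ∞ (gradient (angForm Y)) :=
    (InnerProductSpace.toDual ℝ E3).symm.contDiff.comp ((contDiff_angForm hY).fderiv_right (m := ∞) (by exact_mod_cast le_top))
  exact (contDiff_cross_gradient hY).inner ℝ hg

/-- **Homogeneity of the bracket**: `A₂(c y) = c^{4l−4} A₂(y)` for `c > 0`. [folklore] -/
theorem pbr_angForm_smul (hY : IsSolidHarmonic l Y) {c : ℝ} (hc : 0 < c) (y : E3) :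
    pbr Y (angForm Y) (c • y) = c ^ ((4 * l : ℤ) - 4) • pbr Y (angForm Y) y := by
  rw [pbr_eq_inner_cross, pbr_eq_inner_cross, hY.gradient_smul c hc, gradient_angForm_smul hY hc]
  have e1 : cross (c • y) (c ^ ((l : ℤ) - 1) • gradient Y y) = (c * c ^ ((l : ℤ) - 1)) • cross y (gradient Y y) :=
    cross_smul_smul _ _ _ _
  rw [e1, real_inner_smul_left, real_inner_smul_right, smul_eq_mul]
  have key : c * c ^ ((l : ℤ) - 1) * c ^ ((3 * l : ℤ) - 3 - 1) = c ^ ((4 * l : ℤ) - 4) := by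
    rw [show ((4 * l : ℤ) - 4) = 1 + ((l : ℤ) - 1) + ((3 * l : ℤ) - 3 - 1) by ring,
      zpow_add₀ hc.ne', zpow_add₀ hc.ne', zpow_one]
  linear_combination (⟪cross y (gradient Y y), gradient (angForm Y) y⟫) * key

/-- **Euler's identity for the bracket**: `⟪∇A₂(y), y⟫ = (4l − 4) A₂(y)`. [folklore] -/
theorem inner_gradient_pbr_angForm_self (hY : IsSolidHarmonic l Y) (y : E3) :
    ⟪gradient (pbr Y (angForm Y)) y, y⟫ = ((4 * l : ℝ) - 4) * pbr Y (angForm Y) y := by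
  have hd : DifferentiableAt ℝ (pbr Y (angForm Y)) y := ((contDiff_pbr_angForm hY).differentiable (by simp)) y
  have h := fderiv_apply_self_of_homogeneous (pbr Y (angForm Y)) ((4 * l : ℤ) - 4)
    (fun c hc z => pbr_angForm_smul hY hc z) hd
  rw [gradient, InnerProductSpace.toDual_symm_apply, h, smul_eq_mul]
  push_cast
  ring

/-! ### 3. Radial test functions `Θ(y) = θ(|y|²)` -/

/-- A radial test function is smooth. [folklore] -/
theorem contDiff_radialTest {θ : ℝ → ℝ} (hθ : ContDiff ℝ ∞ θ) : ContDiff ℝ ∞ (fun y : E3 => θ (‖y‖ ^ 2)) :=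
  VirialHorn.contDiff_radial hθ

/-- A radial test function whose profile is supported in `[a, b]` has compact support. [folklore] -/
theorem hasCompactSupport_radialTest {θ : ℝ → ℝ} {b : ℝ} (hθ : ∀ s, b < s → θ s = 0) :
    HasCompactSupport (fun y : E3 => θ (‖y‖ ^ 2)) := by
  refine HasCompactSupport.intro (isCompact_closedBall (0 : E3) (Real.sqrt (max b 0))) fun y hy => ?_
  rw [mem_closedBall_zero_iff, not_le] at hy
  apply hθ
  have h1 : Real.sqrt (max b 0) ^ 2 = max b 0 := Real.sq_sqrt (le_max_right _ _)
  have h2 : max b 0 < ‖y‖ ^ 2 := by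
    rw [← h1]
    exact pow_lt_pow_left₀ hy (Real.sqrt_nonneg _) two_ne_zero
  exact lt_of_le_of_lt (le_max_left _ _) h2

/-- The gradient of a radial test function is radial: `⟪y × w, ∇Θ(y)⟫ = 0`. [folklore] -/
theorem inner_cross_gradient_radialTest {θ : ℝ → ℝ} (hθ : ContDiff ℝ ∞ θ) (y w : E3) :
    ⟪cross y w, gradient (fun z : E3 => θ (‖z‖ ^ 2)) y⟫ = 0 := by
  have h0 : ⟪cross y w, y⟫ = 0 := by
    simp [cross, cross_apply, PiLp.inner_apply, Fin.sum_univ_three]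
    ring
  rw [VirialHorn.gradient_radial (hθ.differentiable (by simp)) y, real_inner_smul_right, h0, mul_zero]

/-- The radial derivative of a radial test function: `⟪∇Θ(y), y⟫ = 2 |y|² θ′(|y|²)`. [folklore] -/
theorem inner_gradient_radialTest_self {θ : ℝ → ℝ} (hθ : ContDiff ℝ ∞ θ) (y : E3) :
    ⟪gradient (fun z : E3 => θ (‖z‖ ^ 2)) y, y⟫ = 2 * ‖y‖ ^ 2 * deriv θ (‖y‖ ^ 2) := by
  rw [VirialHorn.gradient_radial (hθ.differentiable (by simp)) y, real_inner_smul_left, real_inner_self_eq_norm_sq]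
  ring

/-- `div (f y • y) = 3 f(y) + ⟪∇f(y), y⟫`. [folklore] -/
theorem divergence_smul_id {f : E3 → ℝ} {y : E3} (hf : DifferentiableAt ℝ f y) :
    VectorCalculus.divergence (fun z : E3 => f z • z) y = 3 * f y + ⟪gradient f y, y⟫ := by
  have hdivid : VectorCalculus.divergence (fun z : E3 => z) y = 3 := by
    rw [divergence_eq_sum_inner_fderiv (EuclideanSpace.basisFun (Fin 3) ℝ), fderiv_fun_id]
    have h : ∀ i, ⟪(EuclideanSpace.basisFun (Fin 3) ℝ) i, (EuclideanSpace.basisFun (Fin 3) ℝ) i⟫ = (1 : ℝ) := fun i => by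
      rw [real_inner_self_eq_norm_sq, (EuclideanSpace.basisFun (Fin 3) ℝ).orthonormal.1 i, one_pow]
    simp only [ContinuousLinearMap.coe_id', id_eq, h, Finset.sum_const, Finset.card_univ, Fintype.card_fin]
    norm_num
  rw [divergence_smul_apply hf differentiableAt_fun_id, hdivid, real_inner_comm]
  ring

/-! ### 4. The two integration-by-parts identities -/

/-- **ZERO SHELL AVERAGES of the bracket**: `∫ Θ(y) A₂(y) dy = 0` for every radial test function with compactly supported profile —
`A₂ = ⟪R, ∇A⟫` with `R = y × ∇Y` divergence free and tangent to spheres (`⟪R, ∇Θ⟫ = 0`), so `Θ A₂ = div(Θ A R) − A div(Θ R) = div(Θ A R)`.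
[folklore] -/
theorem integral_radialTest_mul_pbr_angForm (hY : IsSolidHarmonic l Y) {θ : ℝ → ℝ} (hθ : ContDiff ℝ ∞ θ) {b : ℝ}
    (hθb : ∀ s, b < s → θ s = 0) :
    ∫ y : E3, θ (‖y‖ ^ 2) * pbr Y (angForm Y) y = 0 := by
  -- `∫ Θ ⟪R, ∇A⟫ = ∫ ⟪∇A, Θ R⟫ = −∫ A div(Θ R)` and `div(Θ R) = Θ div R + ⟪R, ∇Θ⟫ = 0`
  set V : E3 → E3 := fun y => θ (‖y‖ ^ 2) • cross y (gradient Y y) with hV_def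
  have hΘ : ContDiff ℝ ∞ (fun y : E3 => θ (‖y‖ ^ 2)) := contDiff_radialTest hθ
  have hV : ContDiff ℝ 1 V := ((hΘ.smul (contDiff_cross_gradient hY)).of_le (by norm_cast))
  have hVc : HasCompactSupport V := (hasCompactSupport_radialTest hθb).smul_right
  have hA1 : ContDiff ℝ 1 (angForm Y) := (contDiff_angForm hY).of_le (by norm_cast)
  have hibp := integral_inner_gradient_eq_neg_integral_mul_divergence hA1 hV hVc
  have hdiv : ∀ y, VectorCalculus.divergence V y = 0 := fun y => by
    have hΘd : DifferentiableAt ℝ (fun y : E3 => θ (‖y‖ ^ 2)) y := (hΘ.differentiable (by simp)) y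
    have hRd : DifferentiableAt ℝ (fun z : E3 => cross z (gradient Y z)) y :=
      ((contDiff_cross_gradient hY).differentiable (by simp)) y
    rw [hV_def, divergence_smul_apply hΘd hRd, divergence_cross_gradient_eq_zero hY y, mul_zero, zero_add,
      inner_cross_gradient_radialTest hθ]
  have e : (fun y : E3 => θ (‖y‖ ^ 2) * pbr Y (angForm Y) y) = fun y => ⟪gradient (angForm Y) y, V y⟫ := by
    funext y
    rw [pbr_eq_inner_cross, hV_def, real_inner_smul_right, real_inner_comm]
  rw [e, hibp]
  simp [hdiv]

/-- FIRST INTEGRATION BY PARTS: under the premise `α(|y|)² A(y) = {Y, y·∇q}(y)`, for every radial test function,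
`∫ α²A²Θ = −∫ ⟪y,∇q⟫ Θ A₂` (`{Y,g} = ⟪R,∇g⟫`, `R = y × ∇Y` divergence free and tangent to spheres). [folklore] -/
theorem integral_virial_ibp_one (hY : IsSolidHarmonic l Y) {α : ℝ → ℝ} {q : E3 → ℝ} (hq : ContDiff ℝ 2 q)
    (hprem : ∀ y : E3, α ‖y‖ ^ 2 * angForm Y y = pbr Y (fun z => inner ℝ z (gradient q z)) y)
    {θ : ℝ → ℝ} (hθ : ContDiff ℝ ∞ θ) {b : ℝ} (hθb : ∀ s, b < s → θ s = 0) :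
    ∫ y : E3, α ‖y‖ ^ 2 * angForm Y y ^ 2 * θ (‖y‖ ^ 2) =
      -∫ y : E3, inner ℝ y (gradient q y) * (θ (‖y‖ ^ 2) * pbr Y (angForm Y) y) := by
  have hΘ : ContDiff ℝ ∞ (fun y : E3 => θ (‖y‖ ^ 2)) := contDiff_radialTest hθ
  have hΘc : HasCompactSupport (fun y : E3 => θ (‖y‖ ^ 2)) := hasCompactSupport_radialTest hθb
  have hA := contDiff_angForm hY
  have hR := contDiff_cross_gradient hY
  have hgq : ContDiff ℝ 1 (gradient q) :=
    (InnerProductSpace.toDual ℝ E3).symm.contDiff.comp (hq.fderiv_right (m := 1) (by norm_cast))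
  have hg : ContDiff ℝ 1 (fun z : E3 => inner ℝ z (gradient q z)) := contDiff_id.inner ℝ hgq
  set V : E3 → E3 := fun y => (angForm Y y * θ (‖y‖ ^ 2)) • cross y (gradient Y y) with hV_def
  have hV : ContDiff ℝ 1 V := (((hA.mul hΘ).smul hR).of_le (by norm_cast))
  have hVc : HasCompactSupport V := (hΘc.mul_left).smul_right
  have hibp1 := integral_inner_gradient_eq_neg_integral_mul_divergence hg hV hVc
  have hdivV : ∀ y, VectorCalculus.divergence V y = θ (‖y‖ ^ 2) * pbr Y (angForm Y) y := fun y => by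
    have hAd : DifferentiableAt ℝ (angForm Y) y := (hA.differentiable (by simp)) y
    have hΘd : DifferentiableAt ℝ (fun y : E3 => θ (‖y‖ ^ 2)) y := (hΘ.differentiable (by simp)) y
    have hfd : DifferentiableAt ℝ (fun y : E3 => angForm Y y * θ (‖y‖ ^ 2)) y := ((hA.mul hΘ).differentiable (by simp)) y
    have hRd : DifferentiableAt ℝ (fun z : E3 => cross z (gradient Y z)) y := (hR.differentiable (by simp)) y
    rw [hV_def, divergence_smul_apply hfd hRd, divergence_cross_gradient_eq_zero hY y, mul_zero, zero_add,
      gradient_mul' hAd hΘd, inner_add_right, real_inner_smul_right, real_inner_smul_right,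
      inner_cross_gradient_radialTest hθ, mul_zero, zero_add, pbr_eq_inner_cross]
  have e1 : ∀ y : E3, α ‖y‖ ^ 2 * angForm Y y ^ 2 * θ (‖y‖ ^ 2) =
      ⟪gradient (fun z : E3 => inner ℝ z (gradient q z)) y, V y⟫ := fun y => by
    rw [hV_def, real_inner_smul_right, real_inner_comm, ← pbr_eq_inner_cross, ← hprem y]
    ring
  rw [integral_congr_ae (Eventually.of_forall e1), hibp1]
  congr 1
  exact integral_congr_ae (Eventually.of_forall fun y => by simp only [hdivV])

/-- SECOND INTEGRATION BY PARTS: `∫ ⟪y,∇q⟫ Θ A₂ = −∫ q ((4l−1)θ + 2|y|²θ′) A₂` (Euler's identity for the degree-`(4l−4)` form `A₂`). [folklore] -/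
theorem integral_virial_ibp_two (hY : IsSolidHarmonic l Y) {q : E3 → ℝ} (hq : ContDiff ℝ 2 q)
    {θ : ℝ → ℝ} (hθ : ContDiff ℝ ∞ θ) {b : ℝ} (hθb : ∀ s, b < s → θ s = 0) :
    ∫ y : E3, inner ℝ y (gradient q y) * (θ (‖y‖ ^ 2) * pbr Y (angForm Y) y) =
      -∫ y : E3, q y * ((((4 * l : ℝ) - 1) * θ (‖y‖ ^ 2) + 2 * ‖y‖ ^ 2 * deriv θ (‖y‖ ^ 2)) * pbr Y (angForm Y) y) := by
  have hΘ : ContDiff ℝ ∞ (fun y : E3 => θ (‖y‖ ^ 2)) := contDiff_radialTest hθ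
  have hΘc : HasCompactSupport (fun y : E3 => θ (‖y‖ ^ 2)) := hasCompactSupport_radialTest hθb
  have hA2 := contDiff_pbr_angForm hY
  set W : E3 → E3 := fun y => (θ (‖y‖ ^ 2) * pbr Y (angForm Y) y) • y with hW_def
  have hW : ContDiff ℝ 1 W := (((hΘ.mul hA2).smul contDiff_id).of_le (by norm_cast))
  have hWc : HasCompactSupport W := (hΘc.mul_right).smul_right
  have hibp2 := integral_inner_gradient_eq_neg_integral_mul_divergence (hq.of_le (by norm_cast)) hW hWc
  have hdivW : ∀ y, VectorCalculus.divergence W y =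
      (((4 * l : ℝ) - 1) * θ (‖y‖ ^ 2) + 2 * ‖y‖ ^ 2 * deriv θ (‖y‖ ^ 2)) * pbr Y (angForm Y) y := fun y => by
    have hΘd : DifferentiableAt ℝ (fun y : E3 => θ (‖y‖ ^ 2)) y := (hΘ.differentiable (by simp)) y
    have hA2d : DifferentiableAt ℝ (pbr Y (angForm Y)) y := (hA2.differentiable (by simp)) y
    have hfd : DifferentiableAt ℝ (fun y : E3 => θ (‖y‖ ^ 2) * pbr Y (angForm Y) y) y := ((hΘ.mul hA2).differentiable (by simp)) y
    rw [hW_def, divergence_smul_id hfd, gradient_mul' hΘd hA2d, inner_add_left, real_inner_smul_left,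
      real_inner_smul_left, inner_gradient_pbr_angForm_self hY, inner_gradient_radialTest_self hθ]
    ring
  have e2 : ∀ y : E3, inner ℝ y (gradient q y) * (θ (‖y‖ ^ 2) * pbr Y (angForm Y) y) = ⟪gradient q y, W y⟫ := fun y => by
    rw [hW_def, real_inner_smul_right, real_inner_comm]
    ring
  rw [integral_congr_ae (Eventually.of_forall e2), hibp2]
  congr 1
  exact integral_congr_ae (Eventually.of_forall fun y => by simp only [hdivW])

/-- **THE WEIGHTED IDENTITY behind the VIRIAL LEMMA.**  Let `Y` be a solid harmonic, `α : ℝ → ℝ` any function, `q : ℝ³ → ℝ` of class `C²`, and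
suppose the premise of `VirialLemmaSlice` in the centred form `α(|y|)² A(y) = {Y, y·∇q}(y)` for all `y`.  Then for every radial test function
`Θ(y) = θ(|y|²)` with compactly supported smooth profile,
`∫ α(|y|)² A(y)² Θ(y) dy = ∫ q(y) · ((4l − 1) θ(|y|²) + 2|y|² θ′(|y|²)) · A₂(y) dy`, `A = {Y,|∇Y|²}`, `A₂ = {Y, A}`
(two integrations by parts; no spherical harmonics, no Poisson equation). [folklore] -/
theorem integral_virial_identity (hY : IsSolidHarmonic l Y) {α : ℝ → ℝ} {q : E3 → ℝ} (hq : ContDiff ℝ 2 q)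
    (hprem : ∀ y : E3, α ‖y‖ ^ 2 * angForm Y y = pbr Y (fun z => inner ℝ z (gradient q z)) y)
    {θ : ℝ → ℝ} (hθ : ContDiff ℝ ∞ θ) {b : ℝ} (hθb : ∀ s, b < s → θ s = 0) :
    ∫ y : E3, α ‖y‖ ^ 2 * angForm Y y ^ 2 * θ (‖y‖ ^ 2) =
      ∫ y : E3, q y * ((((4 * l : ℝ) - 1) * θ (‖y‖ ^ 2) + 2 * ‖y‖ ^ 2 * deriv θ (‖y‖ ^ 2)) * pbr Y (angForm Y) y) := by
  rw [integral_virial_ibp_one hY hq hprem hθ hθb, integral_virial_ibp_two hY hq hθ hθb, neg_neg]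

end Summit.NavierStokesRegularity.NavierStokesRegularity.Theorems.UnthreadedRigidity.ThreadingJets

end
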